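import Literature.Probability.LatticeModels.TorusFourierProofs
import Literature.Probability.LatticeModels.ThermodynamicLimit
import Mathlib.Analysis.Normed.Group.InfiniteSum
import Mathlib.Analysis.Complex.Basic
import Mathlib.Topology.Algebra.InfiniteSum.Order
import Mathlib.Topology.Algebra.InfiniteSum.Real
import Mathlib.Order.Filter.AtTopBot.Finset
import HarnessLib

/-!
# Discrete Poisson summation on `(ℤ/Lℤ)^d`: a torus kernel is the sum over images of the
infinite-lattice kernel (the "method of images" for periodic boundary conditions), and converges to it

Topic `Probability/LatticeModels`; namespace `Literature.Probability.LatticeModels` (next to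
`TorusFourierProofs.lean`, whose characters `torusChar k x = ∏ᵢ e^{2πi kᵢxᵢ/L}` of `(ℤ/Lℤ)^d` and
orthogonality relation `sum_torusChar_left` are the only input).

**The statement.** Let `a : ℤ^d → ℂ` be absolutely summable (an infinite-volume kernel: a free
propagator, a covariance, a Green function) and let `â(k) = Σ_{x ∈ ℤ^d} conj χ_k(x̄) a(x)`,
`k ∈ (ℤ/Lℤ)^d`, be its Fourier transform RESTRICTED TO THE TORUS MOMENTA `p = 2πk/L` (`x̄` the
reduction of `x` mod `L`; `conj χ_k(x̄) = e^{-i p·x}`). Then the finite-volume kernel with periodic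
boundary conditions — the inverse torus Fourier transform `L^{-d} Σ_k â(k) χ_k(z̄)` — is the
**periodization** (sum over images) of `a`:

  `L^{-d} Σ_{k ∈ (ℤ/Lℤ)^d} χ_k(z̄) â(k) = Σ_{n ∈ ℤ^d} a(z + L n)`     (`z ∈ ℤ^d`)

(`torusFourierInv_latticeFourierTorus_eq_tsum_translate`, unnormalised form
`sum_torusChar_mul_latticeFourierTorus`). This is Glimm–Jaffe's Prop. 7.3.1 — "the periodic covariance is
given by `C_p(x, y) = Σ_{n_L ∈ ℤ^d} C(x - y + n_L)`" — on the lattice `ℤ^d` instead of `ℝ^d`, where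
the proof is not uniqueness for the boundary value problem but the orthogonality of the `L^d`
characters of `(ℤ/Lℤ)^d` (the discrete Poisson summation formula for the subgroup `Lℤ^d ≤ ℤ^d`):
`Σ_k χ_k(z̄) conj χ_k(x̄) = L^d · [x ≡ z mod L]`, and the fibre `{x : x ≡ z mod L}` is the injective
image of `n ↦ z + Ln`.

**Consequences** (the use made of the formula in finite-volume/infinite-volume comparisons of
fermionic propagators, Benfatto–Giuliani–Mastropietro 2006, footnote 1 on p. 8 of the arXiv text:
"our bounds can be adapted also to the finite `L` case, and the resulting estimates turn out to be
uniform in `L`"): the finite-size correction is the sum over the NON-ZERO images,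
`L^{-d} Σ_k χ_k(z̄) â(k) - a(z) = Σ_{n ≠ 0} a(z + Ln)`, every non-zero image lies outside the box
`{-R, …, R}^d`, `R + 1 + Σᵢ|zᵢ| ≤ L` (`translate_not_mem_box`; the tree's `box d R` of
`ThermodynamicLimit.lean`), hence `‖Σ_n a(z + Ln) - a(z)‖ ≤ Σ_{x ∉ box d R} ‖a(x)‖`
(`norm_tsum_translate_sub_le`) — a tail of the absolutely convergent series — and therefore the
torus kernels converge to the infinite-volume kernel at every site as `L → ∞`
(`tendsto_tsum_translate`, `tendsto_torusFourierInv_latticeFourierTorus`): the thermodynamic limit of a periodized summable kernel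
exists and is the kernel itself, with an explicit, decay-driven rate.

Everything is PROVED; the only definition is `latticeFourierTorus` (the `ℤ^d`-Fourier transform
of a kernel at the torus momenta).

## Mathlib / tree search

Mathlib has the Poisson summation formula on `ℝ` (`Real.tsum_eq_tsum_fourierIntegral`) and the
tree has Tate's for cocompact discrete subgroups of LCA groups
(`Literature.Analysis.Fourier.PoissonSummationCompactQuotient`, Haar-measure formulation); the finite
index case `Lℤ^d ≤ ℤ^d` needed here is elementary and proved directly from
`sum_torusChar_left` (`TorusFourierProofs`). `lean search 'periodiz|PoissonSum'`: nothing on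
`ℤ^d`/`ZMod`.

## References

* J. Glimm, A. Jaffe, *Quantum Physics. A Functional Integral Point of View*, 2nd ed. (Springer
  1987), §7.3, Prop. 7.3.1 (periodic covariance = sum over images). [GlimmJaffeQP1987]
* G. Benfatto, A. Giuliani, V. Mastropietro, Ann. Henri Poincaré 7 (2006) 809–898, §2.2
  footnote 1 (finite `L`, uniformity in `L`), arXiv:cond-mat/0507686 p. 8.
  [BenfattoGiulianiMastropietro2006]
* S. Friedli, Y. Velenik, *Statistical Mechanics of Lattice Systems* (CUP 2017), §10.4 (Fourier
  analysis on the discrete torus). [FriedliVelenik2017]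
-/

noncomputable section

open Finset Filter Complex
open scoped ComplexConjugate Topology

namespace Literature.Probability.LatticeModels

variable {d : ℕ}

/-! ### The fibres of the reduction `ℤ^d → (ℤ/Lℤ)^d` -/

section Fibres

/-- Two integer points have the same reduction mod `L` iff `L` divides every coordinate of their
difference. [folklore] -/
theorem Torus.proj_eq_proj_iff (L : ℕ) (x y : Site d) :
    Torus.proj L x = Torus.proj L y ↔ ∀ i, (L : ℤ) ∣ x i - y i := by
  rw [funext_iff]
  refine forall_congr' fun i => ?_
  rw [Torus.proj_apply, Torus.proj_apply, ZMod.intCast_eq_intCast_iff_dvd_sub]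
  exact dvd_sub_comm

/-- The images `z + Ln` of `z` all reduce to `z̄`. [folklore] -/
theorem Torus.proj_add_zsmul (L : ℕ) (z n : Site d) :
    Torus.proj L (z + (L : ℤ) • n) = Torus.proj L z := by
  rw [Torus.proj_eq_proj_iff]
  intro i
  simp

/-- For `L ≠ 0` the image map `n ↦ z + Ln` is injective. [folklore] -/
theorem translate_zsmul_injective {L : ℕ} (hL : L ≠ 0) (z : Site d) :
    Function.Injective fun n : Site d => z + (L : ℤ) • n := by
  intro n m h
  have h' : (L : ℤ) • n = (L : ℤ) • m := add_left_cancel h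
  funext i
  have hi := congrFun h' i
  simp only [Pi.smul_apply, smul_eq_mul] at hi
  exact mul_left_cancel₀ (Int.natCast_ne_zero.mpr hL) hi

/-- The range of the image map `n ↦ z + Ln` is the fibre of the reduction mod `L` through `z`.
[folklore] -/
theorem mem_range_translate_zsmul_iff (L : ℕ) (z x : Site d) :
    x ∈ Set.range (fun n : Site d => z + (L : ℤ) • n) ↔ Torus.proj L x = Torus.proj L z := by
  rw [Torus.proj_eq_proj_iff]
  constructor
  · rintro ⟨n, rfl⟩ i
    simp
  · intro h
    choose n hn using h
    refine ⟨n, funext fun i => ?_⟩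
    have := hn i
    simp only [Pi.add_apply, Pi.smul_apply, smul_eq_mul]
    linarith

end Fibres

/-! ### The discrete Poisson summation formula -/

section Poisson

variable {L : ℕ} [NeZero L]

/-- **Orthogonality on integer points**: `Σ_k χ_k(z̄) conj χ_k(x̄) = L^d` if `x ≡ z (mod L)` and
`0` otherwise. [folklore] -/
theorem sum_torusChar_proj_mul_conj (z x : Site d) :
    ∑ k : TorusSite d L, torusChar k (Torus.proj L z) * conj (torusChar k (Torus.proj L x)) =
      if Torus.proj L x = Torus.proj L z then (L : ℂ) ^ d else 0 := by
  simp_rw [← torusChar_sub_right, sum_torusChar_left, sub_eq_zero, eq_comm]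

/-- The `ℤ^d`-Fourier transform of a kernel `a : ℤ^d → ℂ` at the torus momentum `k ∈ (ℤ/Lℤ)^d`
(`p = 2πk/L`): `â(k) = Σ_{x ∈ ℤ^d} conj χ_k(x̄) a(x) = Σ_x e^{-i p·x} a(x)` (an unconditional sum;
`0` if not summable). Glimm–Jaffe 1987 §7.3 (periodic b.c. in Fourier space); Friedli–Velenik
2017 §10.4 for the characters. [cite: GlimmJaffeQP1987, §7.3] -/
def latticeFourierTorus (L : ℕ) [NeZero L] (a : Site d → ℂ) (k : TorusSite d L) : ℂ :=
  ∑' x : Site d, conj (torusChar k (Torus.proj L x)) * a x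

/-- Unfolding of `latticeFourierTorus`. [folklore] -/
theorem latticeFourierTorus_apply (a : Site d → ℂ) (k : TorusSite d L) :
    latticeFourierTorus L a k = ∑' x : Site d, conj (torusChar k (Torus.proj L x)) * a x := rfl

/-- The terms of `latticeFourierTorus` are absolutely summable when `a` is. [folklore] -/
theorem summable_conj_torusChar_mul {a : Site d → ℂ} (ha : Summable fun x => ‖a x‖)
    (k : TorusSite d L) : Summable fun x : Site d => conj (torusChar k (Torus.proj L x)) * a x :=
  Summable.of_norm_bounded ha fun x => by rw [norm_mul, RCLike.norm_conj, norm_torusChar, one_mul]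

/-- `|â(k)| ≤ Σ_x |a(x)|`. [folklore] -/
theorem norm_latticeFourierTorus_le {a : Site d → ℂ} (ha : Summable fun x => ‖a x‖) (k : TorusSite d L) :
    ‖latticeFourierTorus L a k‖ ≤ ∑' x : Site d, ‖a x‖ := by
  refine (norm_tsum_le_tsum_norm ?_).trans (le_of_eq (tsum_congr fun x => ?_))
  · simpa only [norm_mul, RCLike.norm_conj, norm_torusChar, one_mul] using ha
  · rw [norm_mul, RCLike.norm_conj, norm_torusChar, one_mul]

/-- **Discrete Poisson summation / sum over images** (Glimm–Jaffe 1987, Prop. 7.3.1 on the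
lattice): for an absolutely summable kernel `a : ℤ^d → ℂ` and `z ∈ ℤ^d`,
`Σ_{k ∈ (ℤ/Lℤ)^d} χ_k(z̄) â(k) = L^d Σ_{n ∈ ℤ^d} a(z + Ln)`. [cite: GlimmJaffeQP1987, Prop. 7.3.1] -/
theorem sum_torusChar_mul_latticeFourierTorus {a : Site d → ℂ} (ha : Summable fun x => ‖a x‖)
    (z : Site d) :
    ∑ k : TorusSite d L, torusChar k (Torus.proj L z) * latticeFourierTorus L a k =
      (L : ℂ) ^ d * ∑' n : Site d, a (z + (L : ℤ) • n) := by
  classical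
  have hs := summable_conj_torusChar_mul (L := L) ha
  calc ∑ k : TorusSite d L, torusChar k (Torus.proj L z) * latticeFourierTorus L a k
      = ∑ k : TorusSite d L, ∑' x : Site d,
          torusChar k (Torus.proj L z) * (conj (torusChar k (Torus.proj L x)) * a x) := by
        simp_rw [latticeFourierTorus, tsum_mul_left]
    _ = ∑' x : Site d, ∑ k : TorusSite d L,
          torusChar k (Torus.proj L z) * (conj (torusChar k (Torus.proj L x)) * a x) :=
        (Summable.tsum_finsetSum fun k _ => (hs k).mul_left _).symm
    _ = ∑' x : Site d, (if Torus.proj L x = Torus.proj L z then (L : ℂ) ^ d else 0) * a x := by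
        refine tsum_congr fun x => ?_
        rw [← sum_torusChar_proj_mul_conj, Finset.sum_mul]
        exact Finset.sum_congr rfl fun k _ => (mul_assoc _ _ _).symm
    _ = ∑' x : Site d, Set.indicator {x | Torus.proj L x = Torus.proj L z}
          (fun x => (L : ℂ) ^ d * a x) x := by
        refine tsum_congr fun x => ?_
        simp only [Set.indicator_apply, Set.mem_setOf_eq, ite_mul, zero_mul]
    _ = ∑' n : Site d, Set.indicator {x | Torus.proj L x = Torus.proj L z}
          (fun x => (L : ℂ) ^ d * a x) (z + (L : ℤ) • n) := by
        refine ((translate_zsmul_injective (NeZero.ne L) z).tsum_eq fun x hx => ?_).symm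
        rw [mem_range_translate_zsmul_iff]
        by_contra h
        exact hx (Set.indicator_of_notMem
          (show x ∉ {x | Torus.proj L x = Torus.proj L z} from h) _)
    _ = ∑' n : Site d, (L : ℂ) ^ d * a (z + (L : ℤ) • n) :=
        tsum_congr fun n => Set.indicator_of_mem
          (show z + (L : ℤ) • n ∈ {x | Torus.proj L x = Torus.proj L z} from
            Torus.proj_add_zsmul L z n) _
    _ = (L : ℂ) ^ d * ∑' n : Site d, a (z + (L : ℤ) • n) := tsum_mul_left

/-- **Periodization** (Glimm–Jaffe 1987, Prop. 7.3.1 on the lattice; the normalised form): the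
inverse torus Fourier transform of `â` restricted to the torus momenta is the sum of `a` over the
images, `L^{-d} Σ_k χ_k(z̄) â(k) = Σ_{n ∈ ℤ^d} a(z + Ln)` — the finite-volume kernel with periodic
boundary conditions is the periodization of the infinite-volume one.
[cite: GlimmJaffeQP1987, Prop. 7.3.1] -/
theorem torusFourierInv_latticeFourierTorus_eq_tsum_translate {a : Site d → ℂ}
    (ha : Summable fun x => ‖a x‖) (z : Site d) :
    torusFourierInv (latticeFourierTorus L a) (Torus.proj L z) = ∑' n : Site d, a (z + (L : ℤ) • n) := by
  rw [torusFourierInv_eq_sum_torusChar]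
  simp_rw [mul_comm (latticeFourierTorus L a _)]
  rw [sum_torusChar_mul_latticeFourierTorus ha, ← mul_assoc, inv_mul_cancel₀ natCast_pow_ne_zero, one_mul]

/-- The sum over images is absolutely convergent. [folklore] -/
theorem summable_norm_translate_zsmul {a : Site d → ℂ} (ha : Summable fun x => ‖a x‖) (z : Site d) :
    Summable fun n : Site d => ‖a (z + (L : ℤ) • n)‖ :=
  (ha.comp_injective (translate_zsmul_injective (NeZero.ne L) z) :)

end Poisson

/-! ### The finite-size correction: the non-zero images lie far out -/

section Box

/-- The boxes `box d R = {-R, …, R}^d` exhaust `ℤ^d` in the order of finite sets: `box d R → ⊤`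
as `R → ∞` (monotone, and `x ∈ box d (Σᵢ |xᵢ|)`). [folklore] -/
theorem tendsto_box_atTop : Tendsto (box d) atTop atTop := by
  refine tendsto_atTop_finset_of_monotone (box_mono d) fun x => ⟨∑ i, (x i).natAbs, ?_⟩
  rw [mem_box]
  intro i
  have h1 : ((x i).natAbs : ℤ) ≤ ((∑ j, (x j).natAbs : ℕ) : ℤ) := by
    exact_mod_cast Finset.single_le_sum (f := fun j => (x j).natAbs) (fun j _ => Nat.zero_le _)
      (Finset.mem_univ i)
  rw [Int.natCast_natAbs] at h1
  exact abs_le.1 h1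

/-- **A non-zero image is far out**: if `n ≠ 0` then some coordinate of `z + Ln` has absolute
value `≥ L - |zᵢ|`. [folklore] -/
theorem exists_sub_abs_le_abs_translate (L : ℕ) (z : Site d) {n : Site d} (hn : n ≠ 0) :
    ∃ i, (L : ℤ) - |z i| ≤ |(z + (L : ℤ) • n) i| := by
  obtain ⟨i, hi⟩ : ∃ i, n i ≠ 0 := by
    by_contra h
    push Not at h
    exact hn (funext h)
  refine ⟨i, ?_⟩
  have h1 : (1 : ℤ) ≤ |n i| := Int.one_le_abs hi
  have h2 : |(L : ℤ) * n i| - |z i| ≤ |z i + (L : ℤ) * n i| := by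
    have := abs_sub_abs_le_abs_sub ((L : ℤ) * n i) (-(z i))
    rw [abs_neg, sub_neg_eq_add, add_comm] at this
    exact this
  have h3 : (L : ℤ) ≤ |(L : ℤ) * n i| := by
    rw [abs_mul, Nat.abs_cast]
    nlinarith [Int.natCast_nonneg L]
  simp only [Pi.add_apply, Pi.smul_apply, smul_eq_mul]
  linarith

/-- Hence for `n ≠ 0` the image `z + Ln` lies outside every box `{-R, …, R}^d` with
`R + 1 + Σᵢ|zᵢ| ≤ L`. [folklore] -/
theorem translate_not_mem_box {L R : ℕ} (z : Site d) (hR : (R : ℤ) + 1 + ∑ i, |z i| ≤ L)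
    {n : Site d} (hn : n ≠ 0) : z + (L : ℤ) • n ∉ box d R := by
  obtain ⟨i, hi⟩ := exists_sub_abs_le_abs_translate L z hn
  rw [mem_box]
  intro h
  have hzi : |z i| ≤ ∑ j, |z j| :=
    Finset.single_le_sum (f := fun j => |z j|) (fun j _ => abs_nonneg _) (Finset.mem_univ i)
  have := abs_le.2 (h i)
  linarith

end Box

/-! ### Convergence of the periodization to the kernel as `L → ∞` -/

section Limit

/-- The tail functional `T(s) = Σ_{x ∉ s} ‖a x‖` written without subtypes. [folklore] -/
theorem tsum_subtype_notMem_eq_tsum_ite {a : Site d → ℂ} (s : Finset (Site d)) :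
    ∑' x : {x // x ∉ s}, ‖a x‖ = ∑' x : Site d, if x ∈ s then 0 else ‖a x‖ := by
  classical
  have h := _root_.tsum_subtype ((↑s : Set (Site d))ᶜ) (fun x => ‖a x‖)
  have h1 : ∑' x : {x // x ∉ s}, ‖a x‖ = ∑' x : ((↑s : Set (Site d))ᶜ : Set (Site d)), ‖a x‖ := rfl
  rw [h1, h]
  refine tsum_congr fun x => ?_
  by_cases hx : x ∈ s <;> simp [hx]

/-- **The finite-size correction is a tail of the series**: for `L ≠ 0` and every box radius `R`
with `R + 1 + Σᵢ|zᵢ| ≤ L`, `‖Σ_{n ∈ ℤ^d} a(z + Ln) - a(z)‖ ≤ Σ_{x ∉ box d R} ‖a(x)‖` (the left side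
is the sum over the non-zero images, each of which lies outside the box). Glimm–Jaffe 1987, §7.3
(estimates based on (7.3.1)); BGM 2006 footnote 1 (uniformity in `L`). [cite: GlimmJaffeQP1987, §7.3] -/
theorem norm_tsum_translate_sub_le {a : Site d → ℂ} (ha : Summable fun x => ‖a x‖) {L R : ℕ}
    (hL : L ≠ 0) (z : Site d) (hR : (R : ℤ) + 1 + ∑ i, |z i| ≤ L) :
    ‖∑' n : Site d, a (z + (L : ℤ) • n) - a z‖ ≤ ∑' x : {x // x ∉ box d R}, ‖a x‖ := by
  classical
  have hinj := translate_zsmul_injective hL z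
  have hsn : Summable fun n : Site d => ‖a (z + (L : ℤ) • n)‖ := (ha.comp_injective hinj :)
  have hsa : Summable fun n : Site d => a (z + (L : ℤ) • n) := Summable.of_norm hsn
  -- split off the image `n = 0`
  have hsplit : ∑' n : Site d, a (z + (L : ℤ) • n) - a z =
      ∑' n : Site d, if n = 0 then 0 else a (z + (L : ℤ) • n) := by
    rw [hsa.tsum_eq_add_tsum_ite 0, smul_zero, add_zero, add_sub_cancel_left]
  rw [hsplit, tsum_subtype_notMem_eq_tsum_ite]
  -- compare termwise along the injection `n ↦ z + Ln`
  have hg : Summable fun x : Site d => if x ∈ box d R then 0 else ‖a x‖ :=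
    Summable.of_nonneg_of_le (fun x => by split_ifs <;> simp) (fun x => by split_ifs <;> simp) ha
  have hf : Summable fun n : Site d => ‖if n = 0 then 0 else a (z + (L : ℤ) • n)‖ :=
    Summable.of_nonneg_of_le (fun n => norm_nonneg _)
      (fun n => by split_ifs <;> simp) hsn
  refine (norm_tsum_le_tsum_norm hf).trans ?_
  refine Summable.tsum_le_tsum_of_inj (fun n : Site d => z + (L : ℤ) • n) hinj
    (fun x _ => by split_ifs <;> simp) (fun n => ?_) hf hg
  by_cases hn : n = 0
  · simp only [hn, if_true, norm_zero]
    split_ifs <;> simp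
  · have hnb : z + (L : ℤ) • n ∉ box d R := translate_not_mem_box z hR hn
    simp only [hn, if_false, hnb, le_refl]

/-- **The periodization converges to the kernel**: for an absolutely summable `a : ℤ^d → ℂ` and
every `z`, `Σ_{n ∈ ℤ^d} a(z + Ln) → a(z)` as `L → ∞` (the tail bound `norm_tsum_translate_sub_le`
with `R = L - 1 - Σ|zᵢ|`, and `Σ_{x ∉ s} ‖a x‖ → 0` as the finite set `s` exhausts `ℤ^d`).
Glimm–Jaffe 1987, §7.3. [cite: GlimmJaffeQP1987, §7.3] -/
theorem tendsto_tsum_translate {a : Site d → ℂ} (ha : Summable fun x => ‖a x‖) (z : Site d) :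
    Tendsto (fun L : ℕ => ∑' n : Site d, a (z + (L : ℤ) • n)) atTop (𝓝 (a z)) := by
  rw [tendsto_iff_norm_sub_tendsto_zero]
  set M : ℕ := ∑ i, (z i).natAbs with hM
  have hMz : (M : ℤ) = ∑ i, |z i| := by
    rw [hM, Nat.cast_sum]
    exact Finset.sum_congr rfl fun i _ => Int.natCast_natAbs (z i)
  -- the radii `R(L) = L - 1 - M → ∞`, hence `box d (R L) → ⊤`
  have hbox : Tendsto (fun L : ℕ => box d (L - 1 - M)) atTop atTop := by
    refine tendsto_box_atTop.comp ?_
    rw [tendsto_atTop_atTop]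
    exact fun b => ⟨b + 1 + M, fun L hL => by omega⟩
  have htail : Tendsto (fun L : ℕ => ∑' x : {x // x ∉ box d (L - 1 - M)}, ‖a x‖) atTop (𝓝 0) :=
    (tendsto_tsum_compl_atTop_zero fun x => ‖a x‖).comp hbox
  refine squeeze_zero_norm' ?_ htail
  filter_upwards [eventually_ge_atTop (M + 1)] with L hL
  rw [norm_norm]
  refine norm_tsum_translate_sub_le ha (by omega) z ?_
  rw [← hMz]
  have : ((L - 1 - M : ℕ) : ℤ) + 1 + M = L := by omega
  exact this.le

variable {L : ℕ}

/-- **Thermodynamic limit of a periodized kernel**: with `G_L(z) = L^{-d} Σ_k χ_k(z̄) â(k)` the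
torus kernel built from the absolutely summable infinite-volume kernel `a`, `G_L(z) → a(z)` as
`L → ∞`, for every `z ∈ ℤ^d` (uniqueness of the infinite-volume limit, with the rate of
`norm_tsum_translate_sub_le`). Glimm–Jaffe 1987, Prop. 7.3.1 and §7.3; BGM 2006 footnote 1.
[cite: GlimmJaffeQP1987, Prop. 7.3.1] -/
theorem tendsto_torusFourierInv_latticeFourierTorus {a : Site d → ℂ} (ha : Summable fun x => ‖a x‖)
    (z : Site d) :
    Tendsto (fun L : ℕ => if hL : L = 0 then (0 : ℂ) else
      haveI : NeZero L := ⟨hL⟩; torusFourierInv (latticeFourierTorus L a) (Torus.proj L z))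
      atTop (𝓝 (a z)) := by
  refine (tendsto_tsum_translate ha z).congr' ?_
  filter_upwards [eventually_ne_atTop 0] with L hL
  rw [dif_neg hL]
  haveI : NeZero L := ⟨hL⟩
  exact (torusFourierInv_latticeFourierTorus_eq_tsum_translate ha z).symm

end Limit

end Literature.Probability.LatticeModels

end
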